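import Mathlib
import HarnessLib
import Summits.HubbardSuperconductivity.HubbardSuperconductivity.Theorems.KLProgrammeKLRegimeTwoVolumeReadoutPin
import Summits.HubbardSuperconductivity.HubbardSuperconductivity.Theorems.KLProgrammeKLRegimeVolumeLimitNestedPoisson
import Summits.HubbardSuperconductivity.HubbardSuperconductivity.Theorems.KLProgrammeKLRegimeVolumeLimitTorusPeriodisationSplit

/-!
# Route `KLProgramme` — crux K3, VL child `KLRegimeVolumeLimitV17F2` (stmt-HubbardSuperconductivity-20440), ROUTE A bracket (A5) FOR THE VL STUB:
# the two-volume read-out of a self-energy string AT A COMMON GRID MOMENTUM from the pinned two-leg grid defect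
# (cell gate-hubbard-kl, seat hubbard-kl-k3c5-p3 g9, technique «OS-positivity-free direct assembly»)

The registered stub `stub_vl_nestedFramed` compares, for nested volumes `L ∣ L″` and the SAME lattice momentum `p_{k″} = p_k`, the last-scale carriers
`klSelfEnergy L M … K^{(L)} klE0 (n_β+1) (ω,k) 0` and `klSelfEnergy L″ M … K^{(L″)} klE0 (n_β+1) (ω,k″) 0`.  k3c5-p2's read-out chain
(`…TwoVolumeGridReadout/…SiteKernel/…ResummedReadout/…ReadoutPin`) serves the ENGINE child's local part `ν_n(K)(θ)` — an interpolant VALUE on the Fermi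
curve, hence cosine coefficients, a `τ̌`-convolution and first moments.  At a grid momentum the read-out is simpler and this file supplies it:

* §1 **`norm_selfEnergy_sub_selfEnergy_le_gridDefect_of_latticeMomentum_eq`** (abstract grids `P`, `P′`, grid representations `map S W`, `map S′ W′`,
  nested `Lf = b·Lc`, block embedding `ι`, base point at the origin, base-point–independent rows): for `p_{k″} = p_k`,
  `‖Σ_G((ω,k),σ) − Σ_{G′}((ω,k″),σ)‖ ≤ (2N/|β|)·[Σ_{p₁}‖W(o,p₁) − W′(ιo,ιp₁)‖ + Σ_{p₁′ ∉ range ι}‖W′(ιo,p₁′)‖]` —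
  Fourier inversion `Σ = torusFourier σ` + Poisson on nested tori (`Σ_{G′}(k″) = Σ_{x̄} conj χ_k(x̄)·Per σ′(x̄)`, this seat's
  `norm_torusFourier_sub_torusFourier_of_latticeMomentum_eq`) + «periodised ≤ pinned + far» (k3c4-p1's `sum_norm_sub_periodise_le_pinned_add_far`)
  + k3c5-p2's `sum_norm_siteKernel_sub_clift_add_far_le_gridDefect`; and the one-volume size `‖Σ_G((ω,k),σ)‖ ≤ (2N/|β|)·Σ_{p₁}‖W(o,p₁)‖`.
* §2 **`norm_klSelfEnergy_sub_le_resummed_of_latticeMomentum_eq`** — the K-RESUMMED reading (`klSelfEnergy_eq_resummed`, FST 1996 §1) at TWO frames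
  `Kc`, `Kf` (scheme F: each volume in its own flow frame): `Σ^{K}_L = E_K(p) + τ_K(p)·Σ̃^{K}_L`, so at a common momentum
  `‖Σ^{Kc}_{Lc}(ω,k) − Σ^{Kf}_{Lf}(ω,k″)‖ ≤ ‖E_{Kc}(p) − E_{Kf}(p)‖ + ‖τ_{Kc}(p) − τ_{Kf}(p)‖·(2N/|β|)·N₂ + ‖τ_{Kf}(p)‖·(2N/|β|)·Def(W̃c, W̃f)`
  with `W̃c`, `W̃f` grid representations of the purely quartic resummed theories; at a common frame the symbol terms vanish
  (`norm_klSelfEnergy_sub_le_resummed_sameFrame`).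
* the door at a pin for THE grid actions (geometry / representation / rows discharged) is the sequel `…TwoVolumeMomentumReadoutPin`.

Proofs only; no definition; nothing is asserted about the model beyond identities.  References: BGM 2006 §2.1 (2.5), §2.4 (2.38); FST 1996 §1
(«`K` as a vertex»); Friedli–Velenik 2017 §10.4 (Poisson summation on nested tori).
-/

noncomputable section

namespace Summit.HubbardSuperconductivity.HubbardSuperconductivity.Theorems.TwoVolumeDefect

set_option linter.dupNamespace false -- summit = problem name (single-conjunct summit), D-0017

open Finset Literature.MathematicalPhysics.QuantumLattice GrassmannAlgebra Literature.Probability.LatticeModels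
open Summit.HubbardSuperconductivity.HubbardSuperconductivity.Theorems.KLRegimeSplit
open Summit.HubbardSuperconductivity.HubbardSuperconductivity.Theorems.KLProgrammeLegKernels
open Summit.HubbardSuperconductivity.HubbardSuperconductivity.Theorems.TwoLegFourier
open scoped ComplexConjugate

/-! ## §1 The abstract read-out at a common grid momentum -/

section Abstract

variable {d L : ℕ} [NeZero L]

omit [NeZero L] in
/-- `‖torusFourier s k‖ ≤ Σ_y ‖s y‖` (every character has modulus one). [cite: FriedliVelenik2017, §10.4] -/
theorem norm_torusFourier_le_sum_norm [NeZero L] (s : TorusSite d L → ℂ) (k : TorusSite d L) :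
    ‖torusFourier s k‖ ≤ ∑ y : TorusSite d L, ‖s y‖ := by
  rw [torusFourier_eq_sum_torusChar]
  refine (norm_sum_le _ _).trans (Finset.sum_le_sum fun y _ => ?_)
  rw [norm_mul, Complex.norm_conj, norm_torusChar, mul_one]

omit [NeZero L] in
/-- Fourier inversion pointwise: `F k = torusFourier (torusFourierInv F) k`. [cite: FriedliVelenik2017, §10.4] -/
theorem eq_torusFourier_torusFourierInv [NeZero L] (F : TorusSite d L → ℂ) (k : TorusSite d L) :
    F k = torusFourier (torusFourierInv F) k := by
  have h := torusFourier_torusFourierInv_holds (d := d) (L := L) F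
  exact (congrFun h k).symm

end Abstract

section Readout

variable {b Lc Lf M : ℕ} [NeZero Lc] [NeZero Lf]
variable {P P' : Type*} [Fintype P] [DecidableEq P] [Fintype P'] [DecidableEq P']

/-- **ONE-VOLUME SIZE of a self-energy string read through a grid representation**: `‖Σ_G((ω,k),σ)‖ ≤ (2N/|β|)·Σ_{p₁}‖kernel W 2 ((o,σ,+),(p₁,σ,−))‖`
(Fourier inversion + `sum_norm_siteKernel_le`). [cite: BenfattoGiulianiMastropietro2006, §2.1 (2.5)] -/
theorem norm_selfEnergy_map_gridSub_le [NeZero M] {L : ℕ} [NeZero L] {β : ℝ} (hβ : β ≠ 0) {N : ℕ} (x : P → TorusSite 2 L) (τ : P → ℝ)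
    (hP : Fintype.card P = N * L ^ 2) (W : GrassmannAlgebra ℂ (GridLeg P)) (n : MatsubaraIdx M) (σ : Fin 2) {o : P} (hxo : x o = 0)
    (hrow : ∀ (p₀ : P) (y : TorusSite 2 L),
      (∑ p₁ : P, if x p₁ = x p₀ + y then
        Complex.exp (((matsubaraFreq β M n * (τ p₀ - τ p₁) : ℝ) : ℂ) * Complex.I) * kernel ℂ W 2 (fun i => ((![p₀, p₁] i, σ), i))
        else 0) =
      ∑ p₁ : P, if x p₁ = x o + y then
        Complex.exp (((matsubaraFreq β M n * (τ o - τ p₁) : ℝ) : ℂ) * Complex.I) * kernel ℂ W 2 (fun i => ((![o, p₁] i, σ), i))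
        else 0)
    (k : TorusSite 2 L) :
    ‖selfEnergy L M β (ExteriorAlgebra.map (Matrix.toLin' (gridSubMatrix L M β x τ)) W) (n, k) σ‖ ≤
      2 * N / |β| * ∑ p₁ : P, ‖kernel ℂ W 2 (fun i => ((![o, p₁] i, σ), i))‖ := by
  rw [eq_torusFourier_torusFourierInv (fun k : TorusSite 2 L =>
    selfEnergy L M β (ExteriorAlgebra.map (Matrix.toLin' (gridSubMatrix L M β x τ)) W) (n, k) σ) k]
  exact (norm_torusFourier_le_sum_norm _ k).trans (sum_norm_siteKernel_le hβ x τ hP W n σ hxo hrow)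

/-- **THE READ-OUT AT A COMMON GRID MOMENTUM ((A5) for the VL stub).**  Nested volumes `Lf = b·Lc` on the common `N`-point time grid; grid
representations `G = map S W` (coarse), `G′ = map S′ W′` (fine) with base-point–independent phase-weighted rows; the block embedding `ι` onto the
centred block with base point `o` at the origin.  Then for a coarse momentum `k` and a fine momentum `k″` carrying the SAME lattice momentum,
`‖Σ_G((ω,k),σ) − Σ_{G′}((ω,k″),σ)‖ ≤ (2N/|β|)·[Σ_{p₁}‖W(o,p₁) − W′(ιo,ιp₁)‖ + Σ_{p₁′ ∉ range ι}‖W′(ιo,p₁′)‖]` — the pinned two-leg grid defect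
at the block-centre pin. [cite: BenfattoGiulianiMastropietro2006, §2.4 (2.38)] -/
theorem norm_selfEnergy_sub_selfEnergy_le_gridDefect_of_latticeMomentum_eq [NeZero M] (hL : Lf = b * Lc) {β : ℝ} (hβ : β ≠ 0) {N : ℕ}
    (x : P → TorusSite 2 Lc) (τ : P → ℝ) (x' : P' → TorusSite 2 Lf) (τ' : P' → ℝ)
    (hP : Fintype.card P = N * Lc ^ 2) (hP' : Fintype.card P' = N * Lf ^ 2)
    (ι : P → P') (hι : Function.Injective ι) (hιx : ∀ p, x' (ι p) = Torus.proj Lf (Torus.cRep (x p))) (hιτ : ∀ p, τ' (ι p) = τ p)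
    (hblock : ∀ p' : P', Torus.proj Lf (Torus.cRep (fun i => (((x' p' i).val : ℕ) : ZMod Lc))) = x' p' → p' ∈ Set.range ι)
    {o : P} (hxo : x o = 0) (W : GrassmannAlgebra ℂ (GridLeg P)) (W' : GrassmannAlgebra ℂ (GridLeg P')) (n : MatsubaraIdx M) (σ : Fin 2)
    (hrow : ∀ (p₀ : P) (y : TorusSite 2 Lc),
      (∑ p₁ : P, if x p₁ = x p₀ + y then
        Complex.exp (((matsubaraFreq β M n * (τ p₀ - τ p₁) : ℝ) : ℂ) * Complex.I) * kernel ℂ W 2 (fun i => ((![p₀, p₁] i, σ), i))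
        else 0) =
      ∑ p₁ : P, if x p₁ = x o + y then
        Complex.exp (((matsubaraFreq β M n * (τ o - τ p₁) : ℝ) : ℂ) * Complex.I) * kernel ℂ W 2 (fun i => ((![o, p₁] i, σ), i))
        else 0)
    (hrow' : ∀ (p₀' : P') (y : TorusSite 2 Lf),
      (∑ p₁' : P', if x' p₁' = x' p₀' + y then
        Complex.exp (((matsubaraFreq β M n * (τ' p₀' - τ' p₁') : ℝ) : ℂ) * Complex.I) * kernel ℂ W' 2 (fun i => ((![p₀', p₁'] i, σ), i))
        else 0) =
      ∑ p₁' : P', if x' p₁' = x' (ι o) + y then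
        Complex.exp (((matsubaraFreq β M n * (τ' (ι o) - τ' p₁') : ℝ) : ℂ) * Complex.I) * kernel ℂ W' 2 (fun i => ((![ι o, p₁'] i, σ), i))
        else 0)
    {k : TorusSite 2 Lc} {k'' : TorusSite 2 Lf} (hk : latticeMomentum Lf k'' = latticeMomentum Lc k) :
    ‖selfEnergy Lc M β (ExteriorAlgebra.map (Matrix.toLin' (gridSubMatrix Lc M β x τ)) W) (n, k) σ -
        selfEnergy Lf M β (ExteriorAlgebra.map (Matrix.toLin' (gridSubMatrix Lf M β x' τ')) W') (n, k'') σ‖ ≤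
      2 * N / |β| *
        ((∑ p₁ : P, ‖kernel ℂ W 2 (fun i => ((![o, p₁] i, σ), i)) - kernel ℂ W' 2 (fun i => ((![ι o, ι p₁] i, σ), i))‖) +
          ∑ p₁' ∈ univ.filter (fun p₁' : P' => p₁' ∉ Set.range ι), ‖kernel ℂ W' 2 (fun i => ((![ι o, p₁'] i, σ), i))‖) := by
  classical
  set σc : TorusSite 2 Lc → ℂ := torusFourierInv (fun k : TorusSite 2 Lc =>
    selfEnergy Lc M β (ExteriorAlgebra.map (Matrix.toLin' (gridSubMatrix Lc M β x τ)) W) (n, k) σ) with hσc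
  set σf : TorusSite 2 Lf → ℂ := torusFourierInv (fun k : TorusSite 2 Lf =>
    selfEnergy Lf M β (ExteriorAlgebra.map (Matrix.toLin' (gridSubMatrix Lf M β x' τ')) W') (n, k) σ) with hσf
  -- Fourier inversion at both volumes
  rw [eq_torusFourier_torusFourierInv (fun k : TorusSite 2 Lc =>
      selfEnergy Lc M β (ExteriorAlgebra.map (Matrix.toLin' (gridSubMatrix Lc M β x τ)) W) (n, k) σ) k,
    eq_torusFourier_torusFourierInv (fun k : TorusSite 2 Lf =>
      selfEnergy Lf M β (ExteriorAlgebra.map (Matrix.toLin' (gridSubMatrix Lf M β x' τ')) W') (n, k) σ) k'']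
  -- Poisson on nested tori, then «periodised ≤ pinned + far», then the grid defect
  calc ‖torusFourier σc k - torusFourier σf k''‖
      ≤ ∑ y : TorusSite 2 Lc, ‖σc y - ∑ z ∈ univ.filter (fun z : TorusSite 2 Lf => (fun i => (((z i).val : ℕ) : ZMod Lc)) = y), σf z‖ :=
        TwoPointAssembly.norm_torusFourier_sub_torusFourier_of_latticeMomentum_eq hL σc σf hk
    _ ≤ (∑ xbar : TorusSite 2 Lc, ‖σc xbar - σf (Torus.proj Lf (Torus.cRep xbar))‖) +
          ∑ y ∈ univ.filter (fun y : TorusSite 2 Lf => Torus.proj Lf (Torus.cRep (fun i => (((y i).val : ℕ) : ZMod Lc))) ≠ y), ‖σf y‖ :=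
        TwoPointAssembly.sum_norm_sub_periodise_le_pinned_add_far hL σc σf
    _ ≤ _ := sum_norm_siteKernel_sub_clift_add_far_le_gridDefect hL hβ x τ x' τ' hP hP' ι hι hιx hιτ hblock hxo W W' n σ hrow hrow'

end Readout

/-! ## §2 The K-resummed reading at two frames and a common momentum -/

section Resummed

variable {b Lc Lf M : ℕ} [NeZero Lc] [NeZero Lf] [NeZero M]
variable {P P' : Type*} [Fintype P] [DecidableEq P] [Fintype P'] [DecidableEq P']

/-- Three-term algebra of the resummed reading at two frames: `(E₁ + τ₁S₁) − (E₂ + τ₂S₂) = (E₁ − E₂) + (τ₁ − τ₂)S₁ + τ₂(S₁ − S₂)`. [folklore] -/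
theorem resummed_two_frames_split (E₁ E₂ τ₁ τ₂ S₁ S₂ : ℂ) :
    (E₁ + τ₁ * S₁) - (E₂ + τ₂ * S₂) = (E₁ - E₂) + (τ₁ - τ₂) * S₁ + τ₂ * (S₁ - S₂) := by ring

/-- **THE K-RESUMMED TWO-VOLUME READ-OUT AT A COMMON MOMENTUM, TWO FRAMES** (scheme F).  With `u_K` the volume-free resummation symbol of frame `K`
(`p^{K}_L((i,k⃗),σ) = βL²·u_K(p_k⃗)`, hypotheses `huc/huf`), `E_K(q) = K(q) − K(q)²·u_K(q)/(1+u_K(q)K(q))`, `τ_K(q) = (1 − K(q)·u_K(q)/(1+u_K(q)K(q)))²`,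
grid representations `W̃c`, `W̃f` of the purely quartic resummed theories at frames `Kc` (coarse) and `Kf` (fine), unit framed partition functions, and
a common lattice momentum `p = p_k = p_{k″}`:
`‖klSelfEnergy Lc … Kc klE0 n (i,k) σ − klSelfEnergy Lf … Kf klE0 n (i,k″) σ‖`
`≤ ‖E_{Kc}(p) − E_{Kf}(p)‖ + ‖τ_{Kc}(p) − τ_{Kf}(p)‖·(2N/|β|)·Σ_{p₁}‖W̃c(o,p₁)‖ + ‖τ_{Kf}(p)‖·(2N/|β|)·[Σ_{p₁}‖W̃c(o,p₁) − W̃f(ιo,ιp₁)‖ + Σ_{p₁′∉range ι}‖W̃f(ιo,p₁′)‖]`.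
[cite: BenfattoGiulianiMastropietro2006, §2.4 (2.38)] -/
theorem norm_klSelfEnergy_sub_le_resummed_of_latticeMomentum_eq (hL : Lf = b * Lc) {β : ℝ} (hβ : 0 < β) (U μ : ℝ) (Kc Kf : TrigPolyC4v)
    (n : ℕ) {N : ℕ} (xg : P → TorusSite 2 Lc) (τg : P → ℝ) (xg' : P' → TorusSite 2 Lf) (τg' : P' → ℝ)
    (hP : Fintype.card P = N * Lc ^ 2) (hP' : Fintype.card P' = N * Lf ^ 2)
    (ι : P → P') (hι : Function.Injective ι) (hιx : ∀ p, xg' (ι p) = Torus.proj Lf (Torus.cRep (xg p))) (hιτ : ∀ p, τg' (ι p) = τg p)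
    (hblock : ∀ p' : P', Torus.proj Lf (Torus.cRep (fun i => (((xg' p' i).val : ℕ) : ZMod Lc))) = xg' p' → p' ∈ Set.range ι)
    {o : P} (hxo : xg o = 0) (i : MatsubaraIdx M) (σ : Fin 2)
    (uc uf : (Fin 2 → ℝ) → ℂ)
    (huc : ∀ kv : TorusSite 2 Lc, uvSymbolCT Lc M β μ Kc (klScale klE0 n) ((i, kv), σ) = ((β * (Lc : ℝ) ^ 2 : ℝ) : ℂ) * uc (latticeMomentum Lc kv))
    (huf : ∀ kv : TorusSite 2 Lf, uvSymbolCT Lf M β μ Kf (klScale klE0 n) ((i, kv), σ) = ((β * (Lf : ℝ) ^ 2 : ℝ) : ℂ) * uf (latticeMomentum Lf kv))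
    (Wc : GrassmannAlgebra ℂ (GridLeg P)) (Wf : GrassmannAlgebra ℂ (GridLeg P'))
    (hrepc : ExteriorAlgebra.map (Matrix.toLin' (gridSubMatrix Lc M β xg τg)) Wc =
      effAction ℂ (normalCovariance Lc M (fun ks => uvSymbolCT Lc M β μ Kc (klScale klE0 n) ks /
        (1 + uvSymbolCT Lc M β μ Kc (klScale klE0 n) ks * ((Kc.eval (latticeMomentum Lc ks.1.2) / (β * (Lc : ℝ) ^ 2) : ℝ) : ℂ))))
        (hubbardInteraction Lc M β U))
    (hrepf : ExteriorAlgebra.map (Matrix.toLin' (gridSubMatrix Lf M β xg' τg')) Wf =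
      effAction ℂ (normalCovariance Lf M (fun ks => uvSymbolCT Lf M β μ Kf (klScale klE0 n) ks /
        (1 + uvSymbolCT Lf M β μ Kf (klScale klE0 n) ks * ((Kf.eval (latticeMomentum Lf ks.1.2) / (β * (Lf : ℝ) ^ 2) : ℝ) : ℂ))))
        (hubbardInteraction Lf M β U))
    (hZc : IsUnit (effPartitionFn ℂ (normalCovariance Lc M (uvSymbolCT Lc M β μ Kc (klScale klE0 n)))
      (hubbardInteraction Lc M β U + counterQuadratic Lc M β Kc)))
    (hZf : IsUnit (effPartitionFn ℂ (normalCovariance Lf M (uvSymbolCT Lf M β μ Kf (klScale klE0 n)))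
      (hubbardInteraction Lf M β U + counterQuadratic Lf M β Kf)))
    (hrowc : ∀ (p₀ : P) (y : TorusSite 2 Lc),
      (∑ p₁ : P, if xg p₁ = xg p₀ + y then
        Complex.exp (((matsubaraFreq β M i * (τg p₀ - τg p₁) : ℝ) : ℂ) * Complex.I) * kernel ℂ Wc 2 (fun j => ((![p₀, p₁] j, σ), j))
        else 0) =
      ∑ p₁ : P, if xg p₁ = xg o + y then
        Complex.exp (((matsubaraFreq β M i * (τg o - τg p₁) : ℝ) : ℂ) * Complex.I) * kernel ℂ Wc 2 (fun j => ((![o, p₁] j, σ), j))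
        else 0)
    (hrowf : ∀ (p₀' : P') (y : TorusSite 2 Lf),
      (∑ p₁' : P', if xg' p₁' = xg' p₀' + y then
        Complex.exp (((matsubaraFreq β M i * (τg' p₀' - τg' p₁') : ℝ) : ℂ) * Complex.I) * kernel ℂ Wf 2 (fun j => ((![p₀', p₁'] j, σ), j))
        else 0) =
      ∑ p₁' : P', if xg' p₁' = xg' (ι o) + y then
        Complex.exp (((matsubaraFreq β M i * (τg' (ι o) - τg' p₁') : ℝ) : ℂ) * Complex.I) * kernel ℂ Wf 2 (fun j => ((![ι o, p₁'] j, σ), j))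
        else 0)
    {k : TorusSite 2 Lc} {k'' : TorusSite 2 Lf} (hk : latticeMomentum Lf k'' = latticeMomentum Lc k) :
    ‖klSelfEnergy Lc M β U μ Kc klE0 n (i, k) σ - klSelfEnergy Lf M β U μ Kf klE0 n (i, k'') σ‖ ≤
      ‖((Kc.eval (latticeMomentum Lc k) : ℂ) - (Kc.eval (latticeMomentum Lc k) : ℂ) ^ 2 *
            (uc (latticeMomentum Lc k) / (1 + uc (latticeMomentum Lc k) * Kc.eval (latticeMomentum Lc k)))) -
          ((Kf.eval (latticeMomentum Lc k) : ℂ) - (Kf.eval (latticeMomentum Lc k) : ℂ) ^ 2 *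
            (uf (latticeMomentum Lc k) / (1 + uf (latticeMomentum Lc k) * Kf.eval (latticeMomentum Lc k))))‖ +
        ‖(1 - (Kc.eval (latticeMomentum Lc k) : ℂ) * (uc (latticeMomentum Lc k) / (1 + uc (latticeMomentum Lc k) * Kc.eval (latticeMomentum Lc k)))) ^ 2 -
            (1 - (Kf.eval (latticeMomentum Lc k) : ℂ) * (uf (latticeMomentum Lc k) / (1 + uf (latticeMomentum Lc k) * Kf.eval (latticeMomentum Lc k)))) ^ 2‖ *
          (2 * N / |β| * ∑ p₁ : P, ‖kernel ℂ Wc 2 (fun j => ((![o, p₁] j, σ), j))‖) +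
        ‖(1 - (Kf.eval (latticeMomentum Lc k) : ℂ) * (uf (latticeMomentum Lc k) / (1 + uf (latticeMomentum Lc k) * Kf.eval (latticeMomentum Lc k)))) ^ 2‖ *
          (2 * N / |β| *
            ((∑ p₁ : P, ‖kernel ℂ Wc 2 (fun j => ((![o, p₁] j, σ), j)) - kernel ℂ Wf 2 (fun j => ((![ι o, ι p₁] j, σ), j))‖) +
              ∑ p₁' ∈ univ.filter (fun p₁' : P' => p₁' ∉ Set.range ι), ‖kernel ℂ Wf 2 (fun j => ((![ι o, p₁'] j, σ), j))‖)) := by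
  classical
  -- the resummed self-energies read through the grid representations
  set Sc : TorusSite 2 Lc → ℂ := fun k => selfEnergy Lc M β (ExteriorAlgebra.map (Matrix.toLin' (gridSubMatrix Lc M β xg τg)) Wc) (i, k) σ
    with hSc
  set Sf : TorusSite 2 Lf → ℂ := fun k => selfEnergy Lf M β (ExteriorAlgebra.map (Matrix.toLin' (gridSubMatrix Lf M β xg' τg')) Wf) (i, k) σ
    with hSf
  -- the resummed reading at each volume
  have hreadc : klSelfEnergy Lc M β U μ Kc klE0 n (i, k) σ =
      ((Kc.eval (latticeMomentum Lc k) : ℂ) - (Kc.eval (latticeMomentum Lc k) : ℂ) ^ 2 *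
          (uc (latticeMomentum Lc k) / (1 + uc (latticeMomentum Lc k) * Kc.eval (latticeMomentum Lc k)))) +
        (1 - (Kc.eval (latticeMomentum Lc k) : ℂ) * (uc (latticeMomentum Lc k) / (1 + uc (latticeMomentum Lc k) * Kc.eval (latticeMomentum Lc k)))) ^ 2 *
          Sc k := by
    rw [klSelfEnergy_eq_resummed hβ U μ Kc n i k σ hZc (uc (latticeMomentum Lc k)) (huc k), hSc]
    simp only []
    rw [hrepc]
  have hreadf : klSelfEnergy Lf M β U μ Kf klE0 n (i, k'') σ =
      ((Kf.eval (latticeMomentum Lc k) : ℂ) - (Kf.eval (latticeMomentum Lc k) : ℂ) ^ 2 *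
          (uf (latticeMomentum Lc k) / (1 + uf (latticeMomentum Lc k) * Kf.eval (latticeMomentum Lc k)))) +
        (1 - (Kf.eval (latticeMomentum Lc k) : ℂ) * (uf (latticeMomentum Lc k) / (1 + uf (latticeMomentum Lc k) * Kf.eval (latticeMomentum Lc k)))) ^ 2 *
          Sf k'' := by
    rw [klSelfEnergy_eq_resummed hβ U μ Kf n i k'' σ hZf (uf (latticeMomentum Lf k'')) (huf k''), hSf, hk]
    simp only []
    rw [hrepf]
  rw [hreadc, hreadf, resummed_two_frames_split]
  -- the two Grassmann inputs
  have hS : ‖Sc k‖ ≤ 2 * N / |β| * ∑ p₁ : P, ‖kernel ℂ Wc 2 (fun j => ((![o, p₁] j, σ), j))‖ :=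
    norm_selfEnergy_map_gridSub_le hβ.ne' xg τg hP Wc i σ hxo hrowc k
  have hD : ‖Sc k - Sf k''‖ ≤ 2 * N / |β| *
      ((∑ p₁ : P, ‖kernel ℂ Wc 2 (fun j => ((![o, p₁] j, σ), j)) - kernel ℂ Wf 2 (fun j => ((![ι o, ι p₁] j, σ), j))‖) +
        ∑ p₁' ∈ univ.filter (fun p₁' : P' => p₁' ∉ Set.range ι), ‖kernel ℂ Wf 2 (fun j => ((![ι o, p₁'] j, σ), j))‖) :=
    norm_selfEnergy_sub_selfEnergy_le_gridDefect_of_latticeMomentum_eq hL hβ.ne' xg τg xg' τg' hP hP' ι hι hιx hιτ hblock hxo Wc Wf i σ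
      hrowc hrowf hk
  refine (norm_add_le _ _).trans (add_le_add ((norm_add_le _ _).trans (add_le_add le_rfl ?_)) ?_)
  · rw [norm_mul]; exact mul_le_mul_of_nonneg_left hS (norm_nonneg _)
  · rw [norm_mul]; exact mul_le_mul_of_nonneg_left hD (norm_nonneg _)

/-- **Common frame**: at `Kc = Kf = K` (and a common symbol `u`) the explicit-symbol terms vanish and
`‖Σ^{K}_{Lc}(ω,k) − Σ^{K}_{Lf}(ω,k″)‖ ≤ ‖τ_K(p)‖·(2N/|β|)·Def(W̃c, W̃f)`. [cite: BenfattoGiulianiMastropietro2006, §2.4 (2.38)] -/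
theorem norm_klSelfEnergy_sub_le_resummed_sameFrame (hL : Lf = b * Lc) {β : ℝ} (hβ : 0 < β) (U μ : ℝ) (K : TrigPolyC4v)
    (n : ℕ) {N : ℕ} (xg : P → TorusSite 2 Lc) (τg : P → ℝ) (xg' : P' → TorusSite 2 Lf) (τg' : P' → ℝ)
    (hP : Fintype.card P = N * Lc ^ 2) (hP' : Fintype.card P' = N * Lf ^ 2)
    (ι : P → P') (hι : Function.Injective ι) (hιx : ∀ p, xg' (ι p) = Torus.proj Lf (Torus.cRep (xg p))) (hιτ : ∀ p, τg' (ι p) = τg p)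
    (hblock : ∀ p' : P', Torus.proj Lf (Torus.cRep (fun i => (((xg' p' i).val : ℕ) : ZMod Lc))) = xg' p' → p' ∈ Set.range ι)
    {o : P} (hxo : xg o = 0) (i : MatsubaraIdx M) (σ : Fin 2)
    (u : (Fin 2 → ℝ) → ℂ)
    (huc : ∀ kv : TorusSite 2 Lc, uvSymbolCT Lc M β μ K (klScale klE0 n) ((i, kv), σ) = ((β * (Lc : ℝ) ^ 2 : ℝ) : ℂ) * u (latticeMomentum Lc kv))
    (huf : ∀ kv : TorusSite 2 Lf, uvSymbolCT Lf M β μ K (klScale klE0 n) ((i, kv), σ) = ((β * (Lf : ℝ) ^ 2 : ℝ) : ℂ) * u (latticeMomentum Lf kv))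
    (Wc : GrassmannAlgebra ℂ (GridLeg P)) (Wf : GrassmannAlgebra ℂ (GridLeg P'))
    (hrepc : ExteriorAlgebra.map (Matrix.toLin' (gridSubMatrix Lc M β xg τg)) Wc =
      effAction ℂ (normalCovariance Lc M (fun ks => uvSymbolCT Lc M β μ K (klScale klE0 n) ks /
        (1 + uvSymbolCT Lc M β μ K (klScale klE0 n) ks * ((K.eval (latticeMomentum Lc ks.1.2) / (β * (Lc : ℝ) ^ 2) : ℝ) : ℂ))))
        (hubbardInteraction Lc M β U))
    (hrepf : ExteriorAlgebra.map (Matrix.toLin' (gridSubMatrix Lf M β xg' τg')) Wf =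
      effAction ℂ (normalCovariance Lf M (fun ks => uvSymbolCT Lf M β μ K (klScale klE0 n) ks /
        (1 + uvSymbolCT Lf M β μ K (klScale klE0 n) ks * ((K.eval (latticeMomentum Lf ks.1.2) / (β * (Lf : ℝ) ^ 2) : ℝ) : ℂ))))
        (hubbardInteraction Lf M β U))
    (hZc : IsUnit (effPartitionFn ℂ (normalCovariance Lc M (uvSymbolCT Lc M β μ K (klScale klE0 n)))
      (hubbardInteraction Lc M β U + counterQuadratic Lc M β K)))
    (hZf : IsUnit (effPartitionFn ℂ (normalCovariance Lf M (uvSymbolCT Lf M β μ K (klScale klE0 n)))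
      (hubbardInteraction Lf M β U + counterQuadratic Lf M β K)))
    (hrowc : ∀ (p₀ : P) (y : TorusSite 2 Lc),
      (∑ p₁ : P, if xg p₁ = xg p₀ + y then
        Complex.exp (((matsubaraFreq β M i * (τg p₀ - τg p₁) : ℝ) : ℂ) * Complex.I) * kernel ℂ Wc 2 (fun j => ((![p₀, p₁] j, σ), j))
        else 0) =
      ∑ p₁ : P, if xg p₁ = xg o + y then
        Complex.exp (((matsubaraFreq β M i * (τg o - τg p₁) : ℝ) : ℂ) * Complex.I) * kernel ℂ Wc 2 (fun j => ((![o, p₁] j, σ), j))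
        else 0)
    (hrowf : ∀ (p₀' : P') (y : TorusSite 2 Lf),
      (∑ p₁' : P', if xg' p₁' = xg' p₀' + y then
        Complex.exp (((matsubaraFreq β M i * (τg' p₀' - τg' p₁') : ℝ) : ℂ) * Complex.I) * kernel ℂ Wf 2 (fun j => ((![p₀', p₁'] j, σ), j))
        else 0) =
      ∑ p₁' : P', if xg' p₁' = xg' (ι o) + y then
        Complex.exp (((matsubaraFreq β M i * (τg' (ι o) - τg' p₁') : ℝ) : ℂ) * Complex.I) * kernel ℂ Wf 2 (fun j => ((![ι o, p₁'] j, σ), j))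
        else 0)
    {k : TorusSite 2 Lc} {k'' : TorusSite 2 Lf} (hk : latticeMomentum Lf k'' = latticeMomentum Lc k) :
    ‖klSelfEnergy Lc M β U μ K klE0 n (i, k) σ - klSelfEnergy Lf M β U μ K klE0 n (i, k'') σ‖ ≤
      ‖(1 - (K.eval (latticeMomentum Lc k) : ℂ) * (u (latticeMomentum Lc k) / (1 + u (latticeMomentum Lc k) * K.eval (latticeMomentum Lc k)))) ^ 2‖ *
        (2 * N / |β| *
          ((∑ p₁ : P, ‖kernel ℂ Wc 2 (fun j => ((![o, p₁] j, σ), j)) - kernel ℂ Wf 2 (fun j => ((![ι o, ι p₁] j, σ), j))‖) +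
            ∑ p₁' ∈ univ.filter (fun p₁' : P' => p₁' ∉ Set.range ι), ‖kernel ℂ Wf 2 (fun j => ((![ι o, p₁'] j, σ), j))‖)) := by
  have h := norm_klSelfEnergy_sub_le_resummed_of_latticeMomentum_eq hL hβ U μ K K n xg τg xg' τg' hP hP' ι hι hιx hιτ hblock hxo i σ u u
    huc huf Wc Wf hrepc hrepf hZc hZf hrowc hrowf hk
  simp only [sub_self, norm_zero, zero_mul, zero_add, add_zero] at h
  simpa only [zero_add] using h

end Resummed

end Summit.HubbardSuperconductivity.HubbardSuperconductivity.Theorems.TwoVolumeDefect
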